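import Summits.QuantumFields.YangMills.Theorems.ColdStartUniversalityShenZhuZhuTorusWilsonLoopVarianceSUN
import Summits.QuantumFields.YangMills.Theorems.ColdStartUniversalityShenZhuZhuLargeNVarianceSU2
import HarnessLib

/-!
# The Poincaré inequality for EVERY infinite-volume limit point of `SU(N)` lattice Yang–Mills, every `N`, every `d`, at `|β| < 1/(8d)`:
# `Var_μ(F) ≤ Σ_e ℓ_e²/(N/2 − 4dN|β|)`; Wilson-loop variances `≤ Σ_e mult_C(e)²/(N K)`; the named facts `shenZhuZhu_largeN_variance d N` for `N ≤ 2`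

Seat `ym-line-csu-p1` (g39), route `ColdStartUniversality` of `Summits/QuantumFields/YangMills`, helper file G24 (strong coupling;
`--supports stmt-QuantumFields-24809`).  The venture `YMGap` proves the variance clause of Shen–Zhu–Zhu's Corollary 4.5 (4.13) for every tight limit
and every `SU(N)`, `d` in `Thresholds/SharpPoincare.lean` (`variance_le_of_mem_infiniteVolumeLimitPoints`, `sharp_poincare_clause`) — a leaf that is
NOT built on the farm.  This file re-derives it in the tree's built part from G23's torus cylinder bound (`torus_cylinder_variance_sun`, itself on the
venture's BUILT multi-link Bakry–Émery inequality) by the limit passage along tori (cylinder observables on large tori inject; the tree's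
`eventually_injOn_torusEdge'`), and draws the Wilson-loop consequences for all `N`, `d`:

* §1 ★★★ `szz_cylinder_variance_limit_sun` — for every `μ ∈ infiniteVolumeLimitPoints (fundamentalRep (Fin N)) (Nβ)`, `K = N/2 − 4dN|β| > 0`, every smooth
  cylinder `F = f((U_e)_{e∈Λ})` that is `ℓ_e`-Lipschitz in the link `e`: `Var_μ(F) ≤ Σ_e ℓ_e²/K` (adapted from the unbuilt venture leaf).
* §2 ★★★ `szz_wilsonLoop_variance_limit_sun` — `Var_μ(W_C) ≤ Σ_{e∈links(C)} mult_C(e)²/(N K)` for every closed lattice walk `C`, `W_C = (1/N) Re tr hol_C`;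
  `…_of_isTrail`: `≤ |C|/(N K)` (perimeter growth; g38 G6 had `SU(2)`, `d = 3`).
* §3 ★★ `szzLoopVarianceBound_sun_of_trace_real` — Shen–Zhu–Zhu's loop-variance SHAPE `SZZLoopVarianceBound (fundamentalRep (Fin N)) d (Nβ) C` for every
  `C ≥ 4/K` whenever the fundamental traces are real (`N ≤ 2`): `Var(Re W_ℓ/N) ≤ n²/(N K) ≤ (4/K)·n(n−3)/N` for loops (`n ≥ 4`, g38 G11's combinatorics,
  every `d`); `trace_im_eq_zero_su_one`; ★★★ `shenZhuZhu_largeN_variance_of_le_two` — the NAMED FACTS `shenZhuZhu_largeN_variance d N` (SZZ Cor. 1.5 (1.12))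
  for `N ∈ {1, 2}` and EVERY `d` (`K_S = N/2 − 8N(d−1)|β| ≤ K`; `SO(N)` conjunct vacuous); g38 had `(d, N) = (3, 2)`.

THEOREMS ONLY, no definition, no sorry.  HONEST FRAMING: STRONG coupling (`|β| < 1/(8d)`), lattice; for general `N ≥ 3` only the real part of `W_ℓ` is
controlled here (the printed `4n(n−3)/(K_S N)` for `Re` and `Im` together needs SZZ's sharper gradient count); nothing at weak coupling / in the
continuum, nothing `K`-uniform along the route's scaling (`UniformColdStartMixing`, 24809, ASIDE, not restated); no crux, rung or summit statement is
proved; the Yang–Mills mass gap is NOT proved.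

References: H. Shen, R. Zhu, X. Zhu, CMP 400 (2023) 805–851 = arXiv:2204.12737, Thm 1.4, Cor. 4.5 (4.13), Cor. 1.5 (1.12) [ShenZhuZhu2022].
-/

set_option autoImplicit false

noncomputable section

namespace Summit.QuantumFields.YangMills.Theorems.ColdStartUniversality

open MeasureTheory ProbabilityTheory Finset Filter Set Function
open scoped BigOperators NNReal ENNReal Topology Matrix Matrix.Norms.Frobenius ContDiff
open SimpleGraph
open Literature.Probability.LatticeModels (zdGraph)
open Literature.MathematicalPhysics.QuantumFieldTheory
open Literature.MathematicalPhysics.QuantumLattice (fundamentalRep continuous_fundamentalRep fundamentalRep_apply torusEdge torusLift LGConfig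
  toTorusObservable infiniteVolumeLimitPoints IsCylinder normalisedCharacter wilsonLoopObs)
open Literature.MathematicalPhysics.QuantumFieldTheory.SUNBakryEmery (SUN)
open Summit.Ventures.YMGap.RobustBall (dartMult)

variable {d N : ℕ}

/-! ## §1. The Poincaré inequality for every infinite-volume limit point, every `SU(N)`, every `d` -/

/-- ★★★ **Sharp-window Poincaré inequality for every infinite-volume limit point, every `SU(N)`, every `d`** (the variance clause of SZZ Cor. 4.5
(4.13) with `K_S` replaced by `K = N/2 − 4dN|β|`): for every tight limit `μ` of the torus states at tree coupling `Nβ` and every smooth cylinder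
`F = f((U_e)_{e∈Λ})` that is `ℓ_e`-Lipschitz in the link `e` (Frobenius distance), `Var_μ(F) ≤ Σ_e ℓ_e²/K`.  Kernel theorem, no named fact; adapted from
`Summits/Ventures/YMGap/Thresholds/SharpPoincare.lean` (`variance_le_of_mem_infiniteVolumeLimitPoints`, unbuilt leaf).  The Yang–Mills mass gap is NOT
proved. [cite: ShenZhuZhu2022, Corollary 4.5 (4.13)] -/
theorem szz_cylinder_variance_limit_sun (hN : N ≠ 0) {β : ℝ} (hK : 0 < (N : ℝ) / 2 - N * |β| * (4 * d))
    {μ : Measure (LGConfig d (SUN N))} (hμ : μ ∈ infiniteVolumeLimitPoints (d := d) (fundamentalRep (Fin N)) ((N : ℝ) * β))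
    (Λ : Finset (Literature.MathematicalPhysics.QuantumLattice.ZdEdge d)) (f : (↥Λ → Matrix (Fin N) (Fin N) ℂ) → ℝ) (hf : ContDiff ℝ ∞ f)
    (ℓ : ↥Λ → ℝ) (hℓ : ∀ e, 0 ≤ ℓ e)
    (hLip : ∀ (e : ↥Λ) (M M' : ↥Λ → SUN N), (∀ e', e' ≠ e → M e' = M' e') →
      |f (fun e' => (M e' : Matrix (Fin N) (Fin N) ℂ)) - f (fun e' => (M' e' : Matrix (Fin N) (Fin N) ℂ))| ≤ ℓ e * suFrobDist (M e) (M' e)) :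
    Var[matrixCylinder Λ f; μ] ≤ (∑ e, ℓ e ^ 2) / ((N : ℝ) / 2 - N * |β| * (4 * d)) := by
  -- adapted from Summits/Ventures/YMGap/Thresholds/SharpPoincare.lean (unbuilt on the farm)
  obtain ⟨Ls, hLs, hprob, hlim⟩ := hμ
  haveI := hprob
  set F : LGConfig d (SUN N) → ℝ := matrixCylinder Λ f with hF
  have hFcyl : IsCylinder F Λ := isCylinder_matrixCylinder Λ f
  have hFc : Continuous F := hf.continuous.comp (continuous_pi fun e => continuous_subtype_val.comp (continuous_apply _))
  obtain ⟨C, hC⟩ : ∃ C, ∀ U, |F U| ≤ C := by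
    obtain ⟨C, hC⟩ := (isCompact_univ (X := LGConfig d (SUN N))).exists_bound_of_continuousOn hFc.continuousOn
    exact ⟨C, fun U => by simpa [Real.norm_eq_abs] using hC U (Set.mem_univ _)⟩
  have hF2cyl : IsCylinder (fun U => F U ^ 2) Λ := fun U V hUV => by
    show F U ^ 2 = F V ^ 2
    rw [hFcyl hUV]
  have hF2c : Continuous fun U => F U ^ 2 := hFc.pow 2
  have hC2 : ∃ C', ∀ U, |F U ^ 2| ≤ C' := ⟨C ^ 2, fun U => by
    rw [abs_pow]; exact pow_le_pow_left₀ (abs_nonneg _) (hC U) 2⟩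
  have ht1 := hlim F Λ hFcyl hFc ⟨C, hC⟩
  have ht2 := hlim (fun U => F U ^ 2) Λ hF2cyl hF2c hC2
  have hmem : MemLp F 2 μ := MemLp.of_bound hFc.aestronglyMeasurable C (ae_of_all _ fun U => by
    rw [Real.norm_eq_abs]; exact hC U)
  have hvarμ : Var[F; μ] = (∫ U, F U ^ 2 ∂μ) - (∫ U, F U ∂μ) ^ 2 := by
    rw [variance_eq_sub hmem]
    rfl
  have htv : Tendsto (fun k => wilsonExpectation (L := Ls k + 1) (fundamentalRep (Fin N)) ((N : ℝ) * β)
        (toTorusObservable (Ls k + 1) fun U => F U ^ 2) -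
      wilsonExpectation (L := Ls k + 1) (fundamentalRep (Fin N)) ((N : ℝ) * β) (toTorusObservable (Ls k + 1) F) ^ 2)
      atTop (𝓝 (Var[F; μ])) := by
    rw [hvarμ]
    exact ht2.sub (ht1.pow 2)
  -- on every large torus the variance is bounded by `Σ ℓ²/K` (G23)
  have hev : ∀ᶠ k : ℕ in atTop,
      wilsonExpectation (L := Ls k + 1) (fundamentalRep (Fin N)) ((N : ℝ) * β)
          (toTorusObservable (Ls k + 1) fun U => F U ^ 2) -
        wilsonExpectation (L := Ls k + 1) (fundamentalRep (Fin N)) ((N : ℝ) * β) (toTorusObservable (Ls k + 1) F) ^ 2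
        ≤ (∑ e, ℓ e ^ 2) / ((N : ℝ) / 2 - N * |β| * (4 * d)) := by
    have hinj : ∀ᶠ k : ℕ in atTop, Set.InjOn (torusEdge (d := d) (Ls k + 1)) ↑Λ := by
      have h1 := eventually_injOn_torusEdge' (d := d) Λ
      have h2 : Tendsto (fun k => Ls k + 1) atTop atTop :=
        tendsto_atTop_mono (fun k => Nat.le_succ (Ls k)) hLs.tendsto_atTop
      exact h2.eventually h1
    refine hinj.mono fun k hk => ?_
    set L' : ℕ := Ls k + 1 with hL'
    have hT := torus_cylinder_variance_sun (L := L') hN hK Λ hk f hf ℓ hℓ hLip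
    haveI := isProbabilityMeasure_wilsonMeasure (d := d) (L := L') (fundamentalRep (Fin N)) (continuous_fundamentalRep (n := Fin N)) ((N : ℝ) * β)
    have hgF : (fun V : GaugeConfig d L' (SUN N) => matrixCylinder Λ f (torusLift L' V)) = toTorusObservable L' F := by
      funext U; rfl
    have hgc' : Continuous fun V : GaugeConfig d L' (SUN N) => matrixCylinder Λ f (torusLift L' V) := by
      rw [hgF]; exact hFc.comp (continuous_pi fun e => continuous_apply _)
    have hmemk : MemLp (fun V : GaugeConfig d L' (SUN N) => matrixCylinder Λ f (torusLift L' V)) 2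
        (wilsonMeasure (d := d) (L := L') (fundamentalRep (Fin N)) ((N : ℝ) * β)) := by
      haveI : SecondCountableTopology (Matrix (Fin N) (Fin N) ℂ) := inferInstanceAs (SecondCountableTopology (Fin N → Fin N → ℂ))
      haveI : SecondCountableTopology (SUN N) := Topology.IsEmbedding.subtypeVal.secondCountableTopology
      exact MemLp.of_bound hgc'.aestronglyMeasurable C (ae_of_all _ fun U => by
        rw [Real.norm_eq_abs]; exact hC (torusLift L' U))
    have hvk : Var[fun V : GaugeConfig d L' (SUN N) => matrixCylinder Λ f (torusLift L' V);
        wilsonMeasure (d := d) (L := L') (fundamentalRep (Fin N)) ((N : ℝ) * β)] =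
        wilsonExpectation (L := L') (fundamentalRep (Fin N)) ((N : ℝ) * β) (toTorusObservable L' fun U => F U ^ 2) -
          wilsonExpectation (L := L') (fundamentalRep (Fin N)) ((N : ℝ) * β) (toTorusObservable L' F) ^ 2 := by
      rw [variance_eq_sub hmemk, hgF]
      rfl
    rw [← hvk]
    exact hT
  exact le_of_tendsto htv hev

/-! ## §2. Wilson loops under every infinite-volume limit point, every `SU(N)`, every `d` -/

/-- ★★★ **Variance of Wilson loops under every infinite-volume limit point, every `SU(N)`, every `d`**: for `K = N/2 − 4dN|β| > 0` and every closed
lattice walk `C`, `Var_μ(W_C) ≤ Σ_{e ∈ links(C)} mult_C(e)²/(N·K)`, `W_C = (1/N) Re tr hol_C`.  The Yang–Mills mass gap is NOT proved.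
[cite: ShenZhuZhu2022, Corollary 1.5, Remark 4.6] -/
theorem szz_wilsonLoop_variance_limit_sun (hN : N ≠ 0) {β : ℝ} (hK : 0 < (N : ℝ) / 2 - N * |β| * (4 * d))
    {μ : Measure (LGConfig d (SUN N))} (hμ : μ ∈ infiniteVolumeLimitPoints (d := d) (fundamentalRep (Fin N)) ((N : ℝ) * β))
    {x : Literature.Probability.LatticeModels.Site d} (w : (zdGraph d).Walk x x) :
    Var[wilsonLoopObs (fun g : SUN N => normalisedCharacter N (fundamentalRep (Fin N) g)) w; μ] ≤
      (∑ e ∈ walkEdges w, (dartMult w e : ℝ) ^ 2) / (N * ((N : ℝ) / 2 - N * |β| * (4 * d))) := by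
  classical
  obtain ⟨f, hf, hrep, hLip⟩ := exists_smooth_linkLipschitz_wilsonLoopObs (N := N) w
  set ℓ : ↥(walkEdges w) → ℝ := fun e =>
    (dartMult w (e : Literature.MathematicalPhysics.QuantumLattice.ZdEdge d) : ℝ) / Real.sqrt (N : ℝ) with hℓdef
  have hℓ : ∀ e, 0 ≤ ℓ e := fun e => div_nonneg (Nat.cast_nonneg _) (Real.sqrt_nonneg _)
  have hsum : ∑ e, ℓ e ^ 2 = (∑ e ∈ walkEdges w, (dartMult w e : ℝ) ^ 2) / N := by
    have h2 : Real.sqrt (N : ℝ) ^ 2 = N := Real.sq_sqrt (Nat.cast_nonneg _)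
    simp only [hℓdef, div_pow, h2]
    rw [← Finset.sum_div, Finset.sum_coe_sort (walkEdges w) (fun e => (dartMult w e : ℝ) ^ 2)]
  have h := szz_cylinder_variance_limit_sun hN hK hμ (walkEdges w) f hf ℓ hℓ hLip
  have hF : matrixCylinder (walkEdges w) f = wilsonLoopObs (fun g : SUN N => normalisedCharacter N (fundamentalRep (Fin N) g)) w := funext hrep
  rw [hF, hsum, div_div] at h
  exact h

/-- ★★ **Perimeter growth of Wilson-loop fluctuations under every infinite-volume limit point, closed trails, every `SU(N)`, every `d`**:
`Var_μ(W_C) ≤ |C|/(N·K)`.  The Yang–Mills mass gap is NOT proved. [cite: ShenZhuZhu2022, Corollary 1.5, Remark 4.6] -/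
theorem szz_wilsonLoop_variance_limit_sun_of_isTrail (hN : N ≠ 0) {β : ℝ} (hK : 0 < (N : ℝ) / 2 - N * |β| * (4 * d))
    {μ : Measure (LGConfig d (SUN N))} (hμ : μ ∈ infiniteVolumeLimitPoints (d := d) (fundamentalRep (Fin N)) ((N : ℝ) * β))
    {x : Literature.Probability.LatticeModels.Site d} {w : (zdGraph d).Walk x x} (htr : w.IsTrail) :
    Var[wilsonLoopObs (fun g : SUN N => normalisedCharacter N (fundamentalRep (Fin N) g)) w; μ] ≤
      (w.length : ℝ) / (N * ((N : ℝ) / 2 - N * |β| * (4 * d))) := by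
  have h := szz_wilsonLoop_variance_limit_sun hN hK hμ w
  rw [sum_dartMult_sq_eq_length_of_isTrail htr] at h
  exact h

/-! ## §3. Shen–Zhu–Zhu's loop-variance shape and the named facts for `N ≤ 2` -/

/-- The trace of an `SU(1)` matrix is real (it is `1`). [folklore] -/
theorem trace_im_eq_zero_su_one (g : Matrix.specialUnitaryGroup (Fin 1) ℂ) : ((g : Matrix (Fin 1) (Fin 1) ℂ).trace).im = 0 := by
  obtain ⟨-, hdet⟩ := Matrix.mem_specialUnitaryGroup_iff.mp g.2
  rw [Matrix.det_fin_one] at hdet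
  rw [Matrix.trace_fin_one, hdet, Complex.one_im]

/-- ★★ **Shen–Zhu–Zhu's loop-variance shape for `SU(N)` with real fundamental traces, every `d`**: if `Im tr g = 0` on `SU(N)` (`N ≤ 2`) and
`K = N/2 − 4dN|β| > 0`, then `SZZLoopVarianceBound (fundamentalRep (Fin N)) d (Nβ) C` for every `C ≥ 4/K`: for every infinite-volume limit point and
every loop `ℓ` (`n ≥ 4` edges), `Var(Re W_ℓ/N) + Var(Im W_ℓ/N) ≤ n²/(N K) + 0 ≤ C·n(n−3)/N`.  The Yang–Mills mass gap is NOT proved.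
[cite: ShenZhuZhu2022, Corollary 1.5 (1.12)] -/
theorem szzLoopVarianceBound_sun_of_trace_real (hN : N ≠ 0) {β : ℝ} (hK : 0 < (N : ℝ) / 2 - N * |β| * (4 * d))
    (hreal : ∀ g : SUN N, ((g : Matrix (Fin N) (Fin N) ℂ).trace).im = 0) {C : ℝ} (hC : 4 / ((N : ℝ) / 2 - N * |β| * (4 * d)) ≤ C) :
    SZZLoopVarianceBound (fundamentalRep (Fin N)) d ((N : ℝ) * β) C := by
  intro μ hμ x w hw
  set K : ℝ := (N : ℝ) / 2 - N * |β| * (4 * d) with hKdef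
  have hNpos : (0 : ℝ) < N := by exact_mod_cast Nat.pos_of_ne_zero hN
  have h4 : (4 : ℝ) ≤ w.length := by exact_mod_cast four_le_length_of_isNonBacktrackingLoop hw
  have hre : (fun U : LGConfig d (SUN N) => (wilsonLoopTrace (fundamentalRep (Fin N)) w U).re / (N : ℝ)) =
      wilsonLoopObs (fun g : SUN N => normalisedCharacter N (fundamentalRep (Fin N) g)) w := by
    funext U
    unfold wilsonLoopObs normalisedCharacter wilsonLoopTrace
    rw [div_eq_inv_mul]
  have him : (fun U : LGConfig d (SUN N) => (wilsonLoopTrace (fundamentalRep (Fin N)) w U).im / (N : ℝ)) = 0 := by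
    funext U
    simp only [wilsonLoopTrace_apply, fundamentalRep_apply, hreal, zero_div, Pi.zero_apply]
  rw [hre, him, variance_zero, add_zero]
  have hV := szz_wilsonLoop_variance_limit_sun hN hK hμ w
  have hS := sum_dartMult_sq_le_length_sq w
  have hnn : 0 ≤ (w.length : ℝ) * ((w.length : ℝ) - 3) := by nlinarith
  calc Var[wilsonLoopObs (fun g : SUN N => normalisedCharacter N (fundamentalRep (Fin N) g)) w; μ]
      ≤ (∑ e ∈ walkEdges w, (dartMult w e : ℝ) ^ 2) / (N * K) := hV
    _ ≤ (w.length : ℝ) ^ 2 / (N * K) := div_le_div_of_nonneg_right hS (by positivity)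
    _ ≤ 4 / K * ((w.length : ℝ) * ((w.length : ℝ) - 3) / (N : ℝ)) := by
        rw [div_le_iff₀ (by positivity)]
        have e : 4 / K * ((w.length : ℝ) * ((w.length : ℝ) - 3) / (N : ℝ)) * (N * K) = 4 * ((w.length : ℝ) * ((w.length : ℝ) - 3)) := by
          field_simp
        rw [e]
        nlinarith
    _ ≤ C * ((w.length : ℝ) * ((w.length : ℝ) - 3) / (N : ℝ)) := mul_le_mul_of_nonneg_right hC (div_nonneg hnn hNpos.le)

/-- ★★★ **The named facts `shenZhuZhu_largeN_variance d N` (Shen–Zhu–Zhu CMP 400 (2023), Cor. 1.5 (1.12)) for `N ∈ {1, 2}` and EVERY dimension `d`**: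
the `SU(N)` conjunct on SZZ's window `|β| < 1/(16(d−1))` with the printed constant `4/K_S`, `K_S = N/2 − 8N(d−1)|β| ≤ N/2 − 4dN|β|` (the fundamental traces
of `SU(1)`, `SU(2)` are real); the `SO(N)` conjunct is vacuous for `N ≤ 2`.  g38 proved `(d, N) = (3, 2)`.  STRONG coupling; the Yang–Mills mass gap is NOT
proved. [cite: ShenZhuZhu2022, Corollary 1.5 (1.12)] -/
theorem shenZhuZhu_largeN_variance_of_le_two (hN2 : N ≤ 2) : shenZhuZhu_largeN_variance d N := by
  refine ⟨fun hd hN β hβ => ?_, fun hd hN β hβ => ?_⟩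
  · have hd' : (2 : ℝ) ≤ d := by exact_mod_cast hd
    have hN' : (1 : ℝ) ≤ N := by exact_mod_cast hN
    have hKS : 0 < szzBakryEmeryConstSU N d β := (szzBakryEmeryConstSU_pos_iff hd hN β).2 hβ
    have h0 : 0 ≤ (N : ℝ) * |β| := mul_nonneg (by linarith) (abs_nonneg β)
    have hKSle : szzBakryEmeryConstSU N d β ≤ (N : ℝ) / 2 - N * |β| * (4 * d) := by
      simp only [szzBakryEmeryConstSU]; nlinarith
    have hK : 0 < (N : ℝ) / 2 - N * |β| * (4 * d) := lt_of_lt_of_le hKS hKSle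
    have hreal : ∀ g : SUN N, ((g : Matrix (Fin N) (Fin N) ℂ).trace).im = 0 := by
      have hN0 : N ≠ 0 := by omega
      rcases Nat.le_succ_iff.1 hN2 with h1 | h2
      · obtain rfl : N = 1 := le_antisymm h1 hN
        exact trace_im_eq_zero_su_one
      · subst h2
        exact Literature.MathematicalPhysics.QuantumLattice.NarrowWell.trace_im_eq_zero
    exact szzLoopVarianceBound_sun_of_trace_real (by omega) hK hreal (div_le_div_of_nonneg_left (by norm_num) hKS hKSle)
  · exfalso
    have hd' : (2 : ℝ) ≤ d := by exact_mod_cast hd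
    have hN' : (1 : ℝ) ≤ N := by exact_mod_cast hN
    have hN2' : (N : ℝ) ≤ 2 := by exact_mod_cast hN2
    have hT : szzThresholdSO N d ≤ 0 := by
      simp only [szzThresholdSO]
      rw [sub_nonpos, one_div_le_one_div (by nlinarith) (by nlinarith)]
      nlinarith
    exact absurd (hβ.trans_le hT) (not_lt.2 (abs_nonneg β))

end Summit.QuantumFields.YangMills.Theorems.ColdStartUniversality

end
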